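import Literature.Geometry.Lorentzian.MGHDUniqueness
import Literature.Geometry.Lorentzian.DevelopmentImmersionInjective

/-!
# Route SwallowTheDatum · item `SubdataDevelopmentsEmbed` (stmt-FinalStateConjecture-10053) —
# relative one-jet determination, rigidity and injectivity of embeddings OVER A SUB-DATUM

Support lemmas for the sub-data half of Choquet-Bruhat–Geroch (route decl
`Summit.FinalStateConjecture.FinalStateConjecture.Theses.SwallowTheDatum.SubdataDevelopmentsEmbed`):
the maps that occur there are time-orientation preserving isometric immersions
`ψ : M₁ → M₂` from (a development of) data `D₁` on `N` to (a development of) data `D₂` on `X`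
which commute with the embeddings of the data manifolds OVER a map `Φ : N → X`,
`ψ ∘ ι₁ = ι₂ ∘ Φ` (in the item, `D₁ = D₂.comap Φ` for a smooth open embedding `Φ` with injective
differentials; none of the lemmas below needs the relation between `D₁` and `D₂`, only that
`dΦ` is pointwise injective — hence bijective, the data manifolds being equidimensional — and,
for injectivity of `ψ`, that `Φ` is injective). They are the RELATIVE forms (`Φ` inserted) of
the tree's same-data lemmas of `CauchyDevelopmentOneJet`, `MGHDUniqueness` and
`DevelopmentImmersionInjective` (the case `N = X`, `Φ = id`), with the same proofs:

* `mfderiv_comp_embed_apply_rel` — `dψ (dι₁ v) = dι₂ (dΦ v)` (chain rule);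
* `mfderiv_normal_rel` — `dψ (ν₁ x) = ν₂ (Φ x)` (uniqueness of the future unit normal,
  `TimeOrientation.eq_of_isFutureUnitNormal`; Sbierski 2016, §3.1, proof of Cor. 3.2);
* `mfderiv_eq_mfderiv_of_comp_embed_eq_rel`, `eq_of_comp_embed_eq_rel` — two such `ψ, ψ'` over
  the same `Φ` have the same one-jet along `ι₁(N)`, hence are EQUAL (`M₁` connected; O'Neill
  1983, Ch. 3, Prop. 3.62 = `IsIsometricImmersion.eq_of_mfderiv_eq`): the coherence needed to
  glue the embeddings of common sub-developments (Sbierski 2016, §3.1, Cor. 3.2 / arXiv Cor. 8);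
* `injective_of_isIsometricImmersion_rel` — between Cauchy developments such a `ψ` is INJECTIVE
  when `Φ` is (Sbierski 2016, Lemma 3.2 = arXiv Lemma 9, relative form: `ψ(ι₁ N) = ι₂(Φ N)` is
  only part of the Cauchy hypersurface `ι₂(X)`; the printed proof goes through because a timelike
  curve of `M₂` still meets `ι₂(X)` at most once), by the tree's integral-curve version of the
  printed argument (pulled-back orienting field `ψ^* T₂`);
* `isOpenEmbedding_of_isIsometricImmersion_rel` — hence `ψ` is a smooth isometric
  time-orientation preserving OPEN EMBEDDING over `Φ` (inverse function theorem), i.e. a witness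
  of exactly the shape the item asks for.

All proved; no definitions, no named facts. References: Sbierski, Ann. Henri Poincaré 17 (2016)
= arXiv:1309.7591, §3.1; Choquet-Bruhat–Geroch, Comm. Math. Phys. 14 (1969), proof of Thm. 3;
O'Neill 1983, Ch. 3, Prop. 3.62, Ch. 5, Lemma 5.26, Ch. 14, Lemma 14.29.
-/

noncomputable section

open Function Set Module Filter Topology VectorField
open scoped Manifold ContDiff Topology

namespace Summit.FinalStateConjecture.FinalStateConjecture.Theorems

namespace SubdataDevelopmentsEmbed

open Literature.Geometry.Lorentzian

universe u v

variable {n : ℕ}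
  {N : Type u} [TopologicalSpace N] [ChartedSpace (EuclideanSpace ℝ (Fin n)) N]
  [IsManifold (𝓡 n) ∞ N] [ConnectedSpace N] {D₁ : InitialDataSet (𝓡 n) N}
  {X : Type v} [TopologicalSpace X] [ChartedSpace (EuclideanSpace ℝ (Fin n)) X]
  [IsManifold (𝓡 n) ∞ X] [ConnectedSpace X] {D₂ : InitialDataSet (𝓡 n) X}

/-! ### The one-jet of an embedding over a sub-datum along the data hypersurface -/

section OneJet

variable (𝒮₁ : DataEmbedding D₁) (𝒮₂ : DataEmbedding D₂)

/-- **Chain rule along the data hypersurface, relative form**: if `ψ ∘ ι₁ = ι₂ ∘ Φ` for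
differentiable `ψ : M₁ → M₂` and `Φ : N → X`, then `dψ (dι₁ v) = dι₂ (dΦ v)`. Sbierski 2016,
§3.1, proof of Cor. 3.2 ("their differentials agree on `Σ` if evaluated on vectors tangent to
`Σ`"), with `Φ` inserted. -/
theorem mfderiv_comp_embed_apply_rel {ψ : 𝒮₁.carrier → 𝒮₂.carrier}
    (hψ : MDifferentiable (𝓡 (n + 1)) (𝓡 (n + 1)) ψ) {Φ : N → X}
    (hΦ : MDifferentiable (𝓡 n) (𝓡 n) Φ) (hψι : ψ ∘ 𝒮₁.embed = 𝒮₂.embed ∘ Φ) (x : N)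
    (v : TangentSpace (𝓡 n) x) :
    mfderiv (𝓡 (n + 1)) (𝓡 (n + 1)) ψ (𝒮₁.embed x) (mfderiv (𝓡 n) (𝓡 (n + 1)) 𝒮₁.embed x v) =
      mfderiv (𝓡 n) (𝓡 (n + 1)) 𝒮₂.embed (Φ x) (mfderiv (𝓡 n) (𝓡 n) Φ x v) := by
  have h₁ := mfderiv_comp x (hψ (𝒮₁.embed x)) (𝒮₁.mdifferentiable_embed x)
  have h₂ := mfderiv_comp x (𝒮₂.mdifferentiable_embed (Φ x)) (hΦ x)
  rw [hψι] at h₁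
  have h := h₁.symm.trans h₂
  exact congrArg (fun L ↦ L v) h

/-- **An embedding over a sub-datum maps the future unit normal to the future unit normal**:
if `ψ : M₁ → M₂` is a time-orientation preserving isometric immersion with `ψ ∘ ι₁ = ι₂ ∘ Φ`,
where `dΦ` is pointwise injective (so bijective: `N`, `X` are equidimensional), then
`dψ (ν₁ x) = ν₂ (Φ x)`: `dψ (ν₁ x)` has square `-1`, is future-directed
(`PreservesTimeOrientation.isFutureDirected_mfderiv`) and is normal to
`dι₂ (T_{Φ x} X) = dι₂ (dΦ (T_x N)) = dψ (dι₁ (T_x N))`, and the future unit normal of a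
spacelike hyperplane is unique (`TimeOrientation.eq_of_isFutureUnitNormal`). Sbierski 2016,
§3.1, proof of Cor. 3.2 ("they both map the future normal of `Σ` onto the future normal"),
relative form. -/
theorem mfderiv_normal_rel {ψ : 𝒮₁.carrier → 𝒮₂.carrier}
    (hψi : 𝒮₁.metric.IsIsometricImmersion 𝒮₂.metric.toPseudoRiemannianMetric ψ)
    (hψτ : 𝒮₁.timeOrientation.PreservesTimeOrientation ψ 𝒮₂.timeOrientation) {Φ : N → X}
    (hΦ : MDifferentiable (𝓡 n) (𝓡 n) Φ) (hΦ' : ∀ x, Injective (mfderiv (𝓡 n) (𝓡 n) Φ x))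
    (hψι : ψ ∘ 𝒮₁.embed = 𝒮₂.embed ∘ Φ) (x : N) :
    mfderiv (𝓡 (n + 1)) (𝓡 (n + 1)) ψ (𝒮₁.embed x) (𝒮₁.normal x) = 𝒮₂.normal (Φ x) := by
  have hψd : MDifferentiable (𝓡 (n + 1)) (𝓡 (n + 1)) ψ := hψi.1.mdifferentiable (by simp)
  have hx : ψ (𝒮₁.embed x) = 𝒮₂.embed (Φ x) := congrFun hψι x
  have key : ∀ u w : TangentSpace (𝓡 (n + 1)) (𝒮₁.embed x),
      𝒮₂.metric.val (ψ (𝒮₁.embed x)) (mfderiv (𝓡 (n + 1)) (𝓡 (n + 1)) ψ (𝒮₁.embed x) u)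
        (mfderiv (𝓡 (n + 1)) (𝓡 (n + 1)) ψ (𝒮₁.embed x) w) =
      𝒮₁.metric.val (𝒮₁.embed x) u w := fun u w ↦ by
    have h := congrArg (fun b ↦ b u w) (hψi.2 (𝒮₁.embed x))
    simpa only [pullbackBilin_apply] using h
  have hsurj : Surjective (mfderiv (𝓡 n) (𝓡 n) Φ x) :=
    (mfderiv_bijective_of_injective (I := 𝓡 n) (I' := 𝓡 n) (hΦ' x) rfl).2
  refine 𝒮₂.timeOrientation.eq_of_isFutureUnitNormal hx.symm
    (mfderiv (𝓡 n) (𝓡 (n + 1)) 𝒮₂.embed (Φ x))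
    (fun v hv ↦ 𝒮₂.val_mfderiv_embed_pos (Φ x) hv)
    (DataEmbedding.finrank_tangentSpace_add_one (Φ x))
    (𝒮₂.isFutureUnitNormal.1.1 (Φ x)) (𝒮₂.isFutureUnitNormal.1.2 (Φ x))
    (𝒮₂.isFutureUnitNormal.2 (Φ x)) (fun v ↦ ?_) ?_ ?_
  · obtain ⟨v', rfl⟩ := hsurj v
    rw [← mfderiv_comp_embed_apply_rel 𝒮₁ 𝒮₂ hψd hΦ hψι x v', key]
    exact 𝒮₁.isFutureUnitNormal.1.1 x v'
  · rw [key]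
    exact 𝒮₁.isFutureUnitNormal.1.2 x
  · exact hψτ.isFutureDirected_mfderiv hψi.2 (𝒮₁.isFutureUnitNormal.2 x)

/-- **The differential of an embedding over a sub-datum along the data hypersurface is
determined by the data and `Φ`**: two time-orientation preserving isometric immersions
`ψ, ψ' : M₁ → M₂` with `ψ ∘ ι₁ = ι₂ ∘ Φ = ψ' ∘ ι₁` (`dΦ` pointwise injective) have the same
differential at every point `ι₁ x` — both send `dι₁ v ↦ dι₂ (dΦ v)`
(`mfderiv_comp_embed_apply_rel`) and `ν₁ x ↦ ν₂ (Φ x)` (`mfderiv_normal_rel`), and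
`T_{ι₁ x} M₁ = dι₁(T_x N) ⊕ ℝ ν₁` (`DataEmbedding.exists_eq_mfderiv_embed_add_smul_normal`).
Sbierski 2016, §3.1, proof of Cor. 3.2, relative form. -/
theorem mfderiv_eq_mfderiv_of_comp_embed_eq_rel {ψ ψ' : 𝒮₁.carrier → 𝒮₂.carrier}
    (hψi : 𝒮₁.metric.IsIsometricImmersion 𝒮₂.metric.toPseudoRiemannianMetric ψ)
    (hψτ : 𝒮₁.timeOrientation.PreservesTimeOrientation ψ 𝒮₂.timeOrientation)
    (hψ'i : 𝒮₁.metric.IsIsometricImmersion 𝒮₂.metric.toPseudoRiemannianMetric ψ')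
    (hψ'τ : 𝒮₁.timeOrientation.PreservesTimeOrientation ψ' 𝒮₂.timeOrientation) {Φ : N → X}
    (hΦ : MDifferentiable (𝓡 n) (𝓡 n) Φ) (hΦ' : ∀ x, Injective (mfderiv (𝓡 n) (𝓡 n) Φ x))
    (hψι : ψ ∘ 𝒮₁.embed = 𝒮₂.embed ∘ Φ) (hψ'ι : ψ' ∘ 𝒮₁.embed = 𝒮₂.embed ∘ Φ) (x : N)
    (w : TangentSpace (𝓡 (n + 1)) (𝒮₁.embed x)) :
    mfderiv (𝓡 (n + 1)) (𝓡 (n + 1)) ψ (𝒮₁.embed x) w =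
      mfderiv (𝓡 (n + 1)) (𝓡 (n + 1)) ψ' (𝒮₁.embed x) w := by
  have hψd : MDifferentiable (𝓡 (n + 1)) (𝓡 (n + 1)) ψ := hψi.1.mdifferentiable (by simp)
  have hψ'd : MDifferentiable (𝓡 (n + 1)) (𝓡 (n + 1)) ψ' := hψ'i.1.mdifferentiable (by simp)
  obtain ⟨v, hw⟩ := 𝒮₁.exists_eq_mfderiv_embed_add_smul_normal x w
  rw [hw, map_add, map_smul, map_add, map_smul,
    mfderiv_comp_embed_apply_rel 𝒮₁ 𝒮₂ hψd hΦ hψι,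
    mfderiv_comp_embed_apply_rel 𝒮₁ 𝒮₂ hψ'd hΦ hψ'ι,
    mfderiv_normal_rel 𝒮₁ 𝒮₂ hψi hψτ hΦ hΦ' hψι,
    mfderiv_normal_rel 𝒮₁ 𝒮₂ hψ'i hψ'τ hΦ hΦ' hψ'ι]
  rfl

/-- **An embedding over a sub-datum is unique** (relative form of Sbierski 2016, §3.1, Cor. 3.2
and of the tree's `DataEmbedding.eq_of_comp_embed_eq`; Choquet-Bruhat–Geroch 1969, p. 332: "ψ
and ψ̃ coincide wherever they are both defined"): two time-orientation preserving isometric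
immersions `ψ, ψ' : M₁ → M₂` with `ψ ∘ ι₁ = ι₂ ∘ Φ = ψ' ∘ ι₁` (`dΦ` pointwise injective) are
EQUAL — they agree to first order at a point of `ι₁(N)` (`N` is nonempty, being connected) and
`M₁` is connected (`IsIsometricImmersion.eq_of_mfderiv_eq`, O'Neill 1983, Ch. 3, Prop. 3.62).
This is the coherence that glues the embeddings of common sub-developments. -/
theorem eq_of_comp_embed_eq_rel {ψ ψ' : 𝒮₁.carrier → 𝒮₂.carrier}
    (hψi : 𝒮₁.metric.IsIsometricImmersion 𝒮₂.metric.toPseudoRiemannianMetric ψ)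
    (hψτ : 𝒮₁.timeOrientation.PreservesTimeOrientation ψ 𝒮₂.timeOrientation)
    (hψ'i : 𝒮₁.metric.IsIsometricImmersion 𝒮₂.metric.toPseudoRiemannianMetric ψ')
    (hψ'τ : 𝒮₁.timeOrientation.PreservesTimeOrientation ψ' 𝒮₂.timeOrientation) {Φ : N → X}
    (hΦ : MDifferentiable (𝓡 n) (𝓡 n) Φ) (hΦ' : ∀ x, Injective (mfderiv (𝓡 n) (𝓡 n) Φ x))
    (hψι : ψ ∘ 𝒮₁.embed = 𝒮₂.embed ∘ Φ) (hψ'ι : ψ' ∘ 𝒮₁.embed = 𝒮₂.embed ∘ Φ) : ψ = ψ' := by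
  obtain ⟨x⟩ : Nonempty N := inferInstance
  have hp : ψ (𝒮₁.embed x) = ψ' (𝒮₁.embed x) := by
    rw [← comp_apply (f := ψ), hψι, ← comp_apply (f := ψ'), hψ'ι]
  refine hψi.eq_of_mfderiv_eq (p := 𝒮₁.embed x) (WithTop.coe_le_coe.mpr le_top) rfl hψ'i hp ?_
  ext w
  exact mfderiv_eq_mfderiv_of_comp_embed_eq_rel 𝒮₁ 𝒮₂ hψi hψτ hψ'i hψ'τ hΦ hΦ' hψι hψ'ι x w

end OneJet

/-! ### The pulled-back orienting field (two data sets) -/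

section Pullback

variable {d : ℕ} {𝒮 : Spacetime.{u} d} {𝒮' : Spacetime.{v} d} {ψ : 𝒮.carrier → 𝒮'.carrier}

/-- The differential of an isometric immersion between (equidimensional) spacetimes is invertible
(the tree's `DataEmbedding.isInvertible_mfderiv_of_isIsometricImmersion`, stated for bare
spacetimes so as to serve two data sets). O'Neill 1983, Ch. 3, p. 58. -/
theorem isInvertible_mfderiv_of_isIsometricImmersion
    (hψ : 𝒮.metric.IsIsometricImmersion 𝒮'.metric.toPseudoRiemannianMetric ψ) (x : 𝒮.carrier) :
    (mfderiv (𝓡 d) (𝓡 d) ψ x).IsInvertible := by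
  have key : ∀ u w : EuclideanSpace ℝ (Fin d),
      𝒮'.metric.val (ψ x) (mfderiv (𝓡 d) (𝓡 d) ψ x u)
        (mfderiv (𝓡 d) (𝓡 d) ψ x w) = 𝒮.metric.val x u w := fun u w ↦
    DFunLike.congr_fun (DFunLike.congr_fun (hψ.2 x) u) w
  exact JetRigidity.isInvertible_of_bijective (F := EuclideanSpace ℝ (Fin d))
    (G := EuclideanSpace ℝ (Fin d))
    (JetRigidity.bijective_of_map_eq (E := EuclideanSpace ℝ (Fin d))
      (F := EuclideanSpace ℝ (Fin d))
      (q₁ := (𝒮.metric.val x : EuclideanSpace ℝ (Fin d) →L[ℝ]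
        EuclideanSpace ℝ (Fin d) →L[ℝ] ℝ))
      (q₂ := (𝒮'.metric.val (ψ x) : EuclideanSpace ℝ (Fin d) →L[ℝ]
        EuclideanSpace ℝ (Fin d) →L[ℝ] ℝ))
      (A := (mfderiv (𝓡 d) (𝓡 d) ψ x : EuclideanSpace ℝ (Fin d) →L[ℝ]
        EuclideanSpace ℝ (Fin d))) rfl (𝒮.metric.nondegenerate x) key)

/-- The pulled-back orienting field `Y = ψ^* T'` is mapped by `dψ` to `T'`. [folklore] -/
theorem mfderiv_mpullback_vectorField
    (hψ : 𝒮.metric.IsIsometricImmersion 𝒮'.metric.toPseudoRiemannianMetric ψ) (x : 𝒮.carrier) :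
    mfderiv (𝓡 d) (𝓡 d) ψ x
        (mpullback (𝓡 d) (𝓡 d) ψ 𝒮'.timeOrientation.vectorField x) =
      𝒮'.timeOrientation.vectorField (ψ x) := by
  rw [mpullback_apply]
  exact (((isInvertible_mfderiv_of_isIsometricImmersion hψ x).inverse_apply_eq).1 rfl).symm

/-- The pulled-back orienting field is timelike: `g(Y, Y) = g'(T', T') < 0`. [folklore] -/
theorem isTimelike_mpullback_vectorField
    (hψ : 𝒮.metric.IsIsometricImmersion 𝒮'.metric.toPseudoRiemannianMetric ψ) (x : 𝒮.carrier) :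
    𝒮.metric.IsTimelike (mpullback (𝓡 d) (𝓡 d) ψ 𝒮'.timeOrientation.vectorField x) := by
  have h := DFunLike.congr_fun (DFunLike.congr_fun (hψ.2 x)
    (mpullback (𝓡 d) (𝓡 d) ψ 𝒮'.timeOrientation.vectorField x))
    (mpullback (𝓡 d) (𝓡 d) ψ 𝒮'.timeOrientation.vectorField x)
  rw [pullbackBilin_apply, mfderiv_mpullback_vectorField hψ x] at h
  change 𝒮.metric.val x _ _ < 0
  rw [← h]
  exact 𝒮'.timeOrientation.isTimelike (ψ x)

/-- The pulled-back orienting field is future-directed when `ψ` preserves the time orientation: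
`g(T, Y) = g'(dψ T, T') < 0`. O'Neill 1983, Ch. 5, p. 145. -/
theorem isFutureDirected_mpullback_vectorField
    (hψ : 𝒮.metric.IsIsometricImmersion 𝒮'.metric.toPseudoRiemannianMetric ψ)
    (hτ : 𝒮.timeOrientation.PreservesTimeOrientation ψ 𝒮'.timeOrientation) (x : 𝒮.carrier) :
    𝒮.timeOrientation.IsFutureDirected
      (mpullback (𝓡 d) (𝓡 d) ψ 𝒮'.timeOrientation.vectorField x) := by
  have ht := isTimelike_mpullback_vectorField hψ x
  refine ⟨⟨le_of_lt ht, fun h0 ↦ ?_⟩, ?_⟩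
  · have ht' : 𝒮.metric.val x
        (mpullback (𝓡 d) (𝓡 d) ψ 𝒮'.timeOrientation.vectorField x)
        (mpullback (𝓡 d) (𝓡 d) ψ 𝒮'.timeOrientation.vectorField x) < 0 := ht
    rw [h0, map_zero] at ht'
    exact (lt_irrefl (0 : ℝ)) ht'
  · have h := DFunLike.congr_fun (DFunLike.congr_fun (hψ.2 x) (𝒮.timeOrientation.vectorField x))
      (mpullback (𝓡 d) (𝓡 d) ψ 𝒮'.timeOrientation.vectorField x)
    rw [pullbackBilin_apply, mfderiv_mpullback_vectorField hψ x] at h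
    change 𝒮.metric.val x _ _ < 0
    rw [← h, 𝒮'.metric.symm]
    exact (hτ x).2

/-- The pulled-back orienting field is `C¹`. [folklore] -/
theorem contMDiff_mpullback_vectorField
    (hψ : 𝒮.metric.IsIsometricImmersion 𝒮'.metric.toPseudoRiemannianMetric ψ) :
    ContMDiff (𝓡 d) (𝓡 d).tangent 1 (fun x ↦
      (⟨x, mpullback (𝓡 d) (𝓡 d) ψ 𝒮'.timeOrientation.vectorField x⟩ :
        TangentBundle (𝓡 d) 𝒮.carrier)) :=
  ContMDiff.mpullback_vectorField (m := 1) (n := 2)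
    (𝒮'.timeOrientation.contMDiff.of_le (by simp))
    (hψ.1.of_le (WithTop.coe_le_coe.mpr le_top : (2 : ℕ∞ω) ≤ ∞))
    (isInvertible_mfderiv_of_isIsometricImmersion hψ) (one_add_one_eq_two (R := ℕ∞ω)).le

/-- `ψ` maps integral curves of `Y = ψ^* T'` to integral curves of `T'` (chain rule). [folklore] -/
theorem isMIntegralCurveAt_comp_of_mpullback
    (hψ : 𝒮.metric.IsIsometricImmersion 𝒮'.metric.toPseudoRiemannianMetric ψ) {γ : ℝ → 𝒮.carrier}
    {t : ℝ}
    (hγ : IsMIntegralCurveAt γ (mpullback (𝓡 d) (𝓡 d) ψ 𝒮'.timeOrientation.vectorField) t) :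
    IsMIntegralCurveAt (ψ ∘ γ) 𝒮'.timeOrientation.vectorField t := by
  have hψd : MDifferentiable (𝓡 d) (𝓡 d) ψ := hψ.1.mdifferentiable (by simp)
  filter_upwards [hγ] with s hs
  have hc := (hψd (γ s)).hasMFDerivAt.comp s hs
  have heq : (mfderiv (𝓡 d) (𝓡 d) ψ (γ s)).comp
      ((1 : ℝ →L[ℝ] ℝ).smulRight
        (mpullback (𝓡 d) (𝓡 d) ψ 𝒮'.timeOrientation.vectorField (γ s))) =
      (1 : ℝ →L[ℝ] ℝ).smulRight (𝒮'.timeOrientation.vectorField ((ψ ∘ γ) s)) := by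
    apply ContinuousLinearMap.ext_ring
    change mfderiv (𝓡 d) (𝓡 d) ψ (γ s)
        ((1 : ℝ) • mpullback (𝓡 d) (𝓡 d) ψ 𝒮'.timeOrientation.vectorField (γ s)) =
      (1 : ℝ) • 𝒮'.timeOrientation.vectorField (ψ (γ s))
    rw [one_smul, one_smul]
    exact mfderiv_mpullback_vectorField hψ (γ s)
  exact hc.congr_mfderiv heq

end Pullback

/-! ### Injectivity of an immersion of Cauchy developments over an injective sub-datum -/

section Injective

/-- **An isometric immersion of Cauchy developments over an injective sub-datum is injective**
(relative form of Sbierski 2016, Lemma 3.2 = arXiv Lemma 9). Let `𝒟₁` be a Cauchy development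
of data on `N`, `𝒟₂` one of data on `X`, `ψ : M₁ → M₂` a time-orientation preserving isometric
immersion with `ψ ∘ ι₁ = ι₂ ∘ Φ` for an injective `Φ : N → X`. Then `ψ` is injective. Proof as
in the tree's same-data version (`CauchyDevelopment.injective_of_isIsometricImmersion`): if
`ψ p = ψ q`, the maximal integral curves `σ`, `γ` of `Y = ψ^* T₂` through `p`, `q` map to one
future timelike curve `κ` of `M₂`; `γ`, `σ` cross the Cauchy hypersurface `ι₁(N)` at parameters
`τ₀`, `τ₁`, where `κ` crosses `ι₂(X) ⊇ ι₂(Φ N)`, so `τ₀ = τ₁` (a timelike curve of `M₂` meets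
`ι₂(X)` at most once — this is where only `ψ(ι₁ N) ⊆ ι₂(X)` is used); as `ι₂ ∘ Φ` is injective,
`γ τ₀ = σ τ₀`, whence `γ = σ` and `p = q`. -/
theorem injective_of_isIsometricImmersion_rel (𝒟₁ : CauchyDevelopment D₁)
    (𝒟₂ : CauchyDevelopment D₂) {ψ : 𝒟₁.carrier → 𝒟₂.carrier}
    (hψ : 𝒟₁.metric.IsIsometricImmersion 𝒟₂.metric.toPseudoRiemannianMetric ψ)
    (hτ : 𝒟₁.timeOrientation.PreservesTimeOrientation ψ 𝒟₂.timeOrientation) {Φ : N → X}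
    (hΦ : Injective Φ) (hι : ψ ∘ 𝒟₁.embed = 𝒟₂.embed ∘ Φ) : Injective ψ := by
  classical
  intro p q hpq
  have hn2 : (2 : ℕ∞ω) ≤ ∞ := WithTop.coe_le_coe.mpr le_top
  set T' := 𝒟₂.timeOrientation.vectorField with hT'def
  have hT' : ContMDiff (𝓡 (n + 1)) (𝓡 (n + 1)).tangent 1
      (fun x ↦ (⟨x, T' x⟩ : TangentBundle (𝓡 (n + 1)) 𝒟₂.carrier)) :=
    𝒟₂.timeOrientation.contMDiff.of_le (by simp)
  -- the pulled-back orienting field on `M₁`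
  set Y := mpullback (𝓡 (n + 1)) (𝓡 (n + 1)) ψ T' with hYdef
  have hY : ContMDiff (𝓡 (n + 1)) (𝓡 (n + 1)).tangent 1
      (fun x ↦ (⟨x, Y x⟩ : TangentBundle (𝓡 (n + 1)) 𝒟₁.carrier)) :=
    contMDiff_mpullback_vectorField (𝒮 := 𝒟₁.toSpacetime) (𝒮' := 𝒟₂.toSpacetime) hψ
  have hYt : ∀ x, 𝒟₁.metric.IsTimelike (Y x) :=
    isTimelike_mpullback_vectorField (𝒮 := 𝒟₁.toSpacetime) (𝒮' := 𝒟₂.toSpacetime) hψ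
  have hYf : ∀ x, 𝒟₁.timeOrientation.IsFutureDirected (Y x) :=
    isFutureDirected_mpullback_vectorField (𝒮 := 𝒟₁.toSpacetime)
      (𝒮' := 𝒟₂.toSpacetime) hψ hτ
  -- maximal integral curves of `Y` through `q` and `p`
  obtain ⟨γ, Dγ, hγ, hDγo, h0γ, hγ0, hγint⟩ :=
    𝒟₁.metric.exists_isEndlessTimelikeCurve_isMIntegralCurveAt 𝒟₁.timeOrientation hY hYt hYf q
  obtain ⟨σ, Dσ, hσ, hDσo, h0σ, hσ0, hσint⟩ :=
    𝒟₁.metric.exists_isEndlessTimelikeCurve_isMIntegralCurveAt 𝒟₁.timeOrientation hY hYt hYf p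
  -- their images are integral curves of `T'` through `ψ q = ψ p`, hence agree on `Dγ ∩ Dσ`
  have hγ' : ∀ t ∈ Dγ, IsMIntegralCurveAt (ψ ∘ γ) T' t := fun t ht ↦
    isMIntegralCurveAt_comp_of_mpullback (𝒮 := 𝒟₁.toSpacetime) (𝒮' := 𝒟₂.toSpacetime)
      hψ (hγint t ht)
  have hσ' : ∀ t ∈ Dσ, IsMIntegralCurveAt (ψ ∘ σ) T' t := fun t ht ↦
    isMIntegralCurveAt_comp_of_mpullback (𝒮 := 𝒟₁.toSpacetime) (𝒮' := 𝒟₂.toSpacetime)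
      hψ (hσint t ht)
  have hagree : EqOn (ψ ∘ γ) (ψ ∘ σ) (Dγ ∩ Dσ) :=
    IntegralCurve.eqOn_of_isOpen_ordConnected hT' (hDγo.inter hDσo) (hγ.1.inter hσ.1)
      (fun t ht ↦ hγ' t ht.1) (fun t ht ↦ hσ' t ht.2) ⟨h0γ, h0σ⟩
      (by simp only [comp_apply, hγ0, hσ0, hpq])
  -- the glued curve `κ` of `M₂`
  set κ : ℝ → 𝒟₂.carrier := fun t ↦ if t ∈ Dγ then ψ (γ t) else ψ (σ t) with hκ
  have hκγ : ∀ t ∈ Dγ, κ t = ψ (γ t) := fun t ht ↦ by simp only [hκ, if_pos ht]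
  have hκσ : ∀ t ∈ Dσ, κ t = ψ (σ t) := fun t ht ↦ by
    by_cases h : t ∈ Dγ
    · rw [hκγ t h]; exact hagree ⟨h, ht⟩
    · simp only [hκ, if_neg h]
  have hκγ' : ∀ t ∈ Dγ, κ =ᶠ[𝓝 t] (ψ ∘ γ) := fun t ht ↦ by
    filter_upwards [hDγo.mem_nhds ht] with t' ht'
    exact hκγ t' ht'
  have hκσ' : ∀ t ∈ Dσ, κ =ᶠ[𝓝 t] (ψ ∘ σ) := fun t ht ↦ by
    filter_upwards [hDσo.mem_nhds ht] with t' ht'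
    exact hκσ t' ht'
  have hκint : ∀ t ∈ Dγ ∪ Dσ, IsMIntegralCurveAt κ T' t := by
    rintro t (ht | ht)
    · exact IntegralCurve.isMIntegralCurveAt_congr (hγ' t ht) (hκγ' t ht)
    · exact IntegralCurve.isMIntegralCurveAt_congr (hσ' t ht) (hκσ' t ht)
  have hκt : 𝒟₂.metric.IsFutureTimelikeCurveOn 𝒟₂.timeOrientation κ (Dγ ∪ Dσ) := fun t ht ↦
    LorentzianMetric.futureTimelikeAt_of_hasMFDerivAt rfl (hκint t ht).hasMFDerivAt
      (𝒟₂.timeOrientation.isTimelike _) (𝒟₂.timeOrientation.isFutureDirected_vectorField _)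
  have hord : (Dγ ∪ Dσ).OrdConnected :=
    isPreconnected_iff_ordConnected.1 ((isPreconnected_iff_ordConnected.2 hγ.1).union 0 h0γ h0σ
      (isPreconnected_iff_ordConnected.2 hσ.1))
  -- the crossings of the Cauchy hypersurfaces
  obtain ⟨τ₀, ⟨hτ₀D, x₀, hx₀⟩, -⟩ := 𝒟₁.isCauchyHypersurface γ Dγ hγ
  obtain ⟨τ₁, ⟨hτ₁D, x₁, hx₁⟩, -⟩ := 𝒟₁.isCauchyHypersurface σ Dσ hσ
  have hκ₀ : κ τ₀ = 𝒟₂.embed (Φ x₀) := by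
    rw [hκγ τ₀ hτ₀D, ← hx₀]; exact congr_fun hι x₀
  have hκ₁ : κ τ₁ = 𝒟₂.embed (Φ x₁) := by
    rw [hκσ τ₁ hτ₁D, ← hx₁]; exact congr_fun hι x₁
  have h01 : τ₀ = τ₁ :=
    LorentzianMetric.IsCauchyHypersurface.eq_of_mem_of_mem hn2 𝒟₂.isCauchyHypersurface hord hκt
      (Or.inl hτ₀D) (Or.inr hτ₁D) ⟨Φ x₀, hκ₀.symm⟩ ⟨Φ x₁, hκ₁.symm⟩
  subst h01
  -- `γ τ₀ = σ τ₀`, as `ι₂ ∘ Φ` is injective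
  have hx : x₀ = x₁ := hΦ (𝒟₂.isSmoothEmbedding.isEmbedding.injective (hκ₀.symm.trans hκ₁))
  have hγσ : γ τ₀ = σ τ₀ := by rw [← hx₀, ← hx₁, hx]
  -- uniqueness of integral curves of `Y`: `γ = σ` on `Dγ ∩ Dσ ∋ 0`
  have heq := IntegralCurve.eqOn_of_isOpen_ordConnected hY (hDγo.inter hDσo) (hγ.1.inter hσ.1)
    (fun t ht ↦ hγint t ht.1) (fun t ht ↦ hσint t ht.2) ⟨hτ₀D, hτ₁D⟩ hγσ ⟨h0γ, h0σ⟩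
  rw [hγ0, hσ0] at heq
  exact heq.symm

/-- **An isometric immersion of Cauchy developments over an injective sub-datum is a smooth,
time-orientation preserving, isometric OPEN EMBEDDING** (relative form of Sbierski 2016,
Lemma 3.2 and the tree's `CauchyDevelopment.embedsInto_of_isIsometricImmersion`): it is injective
(`injective_of_isIsometricImmersion_rel`) and a local diffeomorphism (inverse function theorem,
`Literature.Geometry.Manifold.isLocalDiffeomorphAt_of_mfderiv`), hence open. The conclusion is
exactly the witness shape of the route decl `SubdataDevelopmentsEmbed`. -/
theorem isOpenEmbedding_of_isIsometricImmersion_rel (𝒟₁ : CauchyDevelopment D₁)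
    (𝒟₂ : CauchyDevelopment D₂) {ψ : 𝒟₁.carrier → 𝒟₂.carrier}
    (hψ : 𝒟₁.metric.IsIsometricImmersion 𝒟₂.metric.toPseudoRiemannianMetric ψ)
    (hτ : 𝒟₁.timeOrientation.PreservesTimeOrientation ψ 𝒟₂.timeOrientation) {Φ : N → X}
    (hΦ : Injective Φ) (hι : ψ ∘ 𝒟₁.embed = 𝒟₂.embed ∘ Φ) :
    ContMDiff (𝓡 (n + 1)) (𝓡 (n + 1)) ∞ ψ ∧ IsOpenEmbedding ψ ∧
      𝒟₁.metric.IsIsometricImmersion 𝒟₂.metric.toPseudoRiemannianMetric ψ ∧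
      𝒟₁.timeOrientation.PreservesTimeOrientation ψ 𝒟₂.timeOrientation ∧
      ψ ∘ 𝒟₁.embed = 𝒟₂.embed ∘ Φ := by
  have hloc : IsLocalDiffeomorph (𝓡 (n + 1)) (𝓡 (n + 1)) ∞ ψ := fun x ↦ by
    obtain ⟨e, he⟩ := isInvertible_mfderiv_of_isIsometricImmersion (𝒮 := 𝒟₁.toSpacetime)
      (𝒮' := 𝒟₂.toSpacetime) hψ x
    exact Literature.Geometry.Manifold.isLocalDiffeomorphAt_of_mfderiv (by simp) isOpen_univ
      (mem_univ x) hψ.1.contMDiffOn e he.symm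
  exact ⟨hψ.1, IsOpenEmbedding.of_continuous_injective_isOpenMap hψ.1.continuous
    (injective_of_isIsometricImmersion_rel 𝒟₁ 𝒟₂ hψ hτ hΦ hι) hloc.isLocalHomeomorph.isOpenMap,
    hψ, hτ, hι⟩

end Injective

end SubdataDevelopmentsEmbed

end Summit.FinalStateConjecture.FinalStateConjecture.Theorems

end
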